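import Mathlib
import HarnessLib
import Summits.NavierStokesRegularity.FluidComputer.BurgersLayerStrain

/-!
# The PARAMETER-FREE layer residual of the θ-attribution probe: `λ₊ − λ₋ = ω₀√(1 + r²)` on a stretched shear layer
# (instab lane, door O-acc = O7 / obstruction P3 — companion of `BurgersLayerStrain` (p421748); the «layer_residual»
# column of `HOME/instab2/strainmax_probe.py` v1.2; cell `ns-blowup`, seat `ns-blowup-instab2`)

HONEST FRAMING (human ruling D-0035): nothing here is a claim about Navier–Stokes. WHAT THIS IS NOT: not dynamics —
algebra on the two in-plane strain eigenvalues `λ± = (−γ ± √(γ² + ω₀²))/2` of the Burgers-layer gradient of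
`BurgersLayerStrain` (`ω₀` = local vorticity, `γ` = stretching along it, `r = γ/ω₀`).

The probe's v1.2 number «layer_residual» is `(λ_max − λ_min)/|ω_loc| − √(1 + r²)` with `r = λ_int/|ω_loc|` read at
the strain maximum. For the model layer the spread of the in-plane eigenvalues is EXACTLY `λ₊ − λ₋ = √(γ² + ω₀²)
= ω₀√(1 + r²)` for every `γ` — no fitted parameter — so the residual vanishes identically on a Burgers-layer gradient
and measures the departure from «one strained layer» (STATUS 2026-08-26, instab2 g5 GENERIC ARM: `+0.006` on the
stage-1 wrapped layer at 5.8 T_h, `+0.95` in the induction-dominated generic burst at 6.1 T_h where `λ_e − λ_c ≈ 2|ω_loc|`).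

## What is proved (Mathlib + `BurgersLayerStrain`; no definitions)
`lam_plus_sub_lam_minus` (`λ₊ − λ₋ = √(γ² + ω₀²)`), `lam_plus_sub_lam_minus_eq_ratio` (`= ω₀√(1 + r²)`, `ω₀ > 0`),
`layer_residual_eq_zero` (`(λ₊ − λ₋)/ω₀ − √(1 + r²) = 0`), `sheet_spread` (`γ = 0`: spread `= ω₀`),
`spread_ge_omega` (`λ₊ − λ₋ ≥ |ω₀|`: stretching only WIDENS the spread — a measured spread below `|ω_loc|` is not a
layer), `record_spread_bounds` (`√(1 + 0.058²) ∈ (1.00168, 1.00169)` vs the measured `1.010`: residual `+0.008`).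
LABEL: MODEL-door kinematics (instrument calibration). WHAT THIS IS NOT: not NS.
-/

namespace Summit.NavierStokesRegularity.FluidComputer.BurgersLayerResidual

open Real

/-- THE EIGENVALUE SPREAD: `λ₊ − λ₋ = √(γ² + ω₀²)`. -/
theorem lam_plus_sub_lam_minus (ω₀ γ : ℝ) :
    (-γ + sqrt (γ ^ 2 + ω₀ ^ 2)) / 2 - (-γ - sqrt (γ ^ 2 + ω₀ ^ 2)) / 2 = sqrt (γ ^ 2 + ω₀ ^ 2) := by ring

/-- IN THE RATIO `r = γ/ω₀` (`ω₀ > 0`): `λ₊ − λ₋ = ω₀·√(1 + r²)`. -/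
theorem lam_plus_sub_lam_minus_eq_ratio {ω₀ γ : ℝ} (hω : 0 < ω₀) :
    (-γ + sqrt (γ ^ 2 + ω₀ ^ 2)) / 2 - (-γ - sqrt (γ ^ 2 + ω₀ ^ 2)) / 2 = ω₀ * sqrt (1 + (γ / ω₀) ^ 2) := by
  rw [lam_plus_sub_lam_minus]
  have h1 : γ ^ 2 + ω₀ ^ 2 = ω₀ ^ 2 * (1 + (γ / ω₀) ^ 2) := by field_simp; ring
  rw [h1, sqrt_mul' _ (by positivity), sqrt_sq hω.le]

/-- THE RESIDUAL VANISHES on the model gradient: `((λ₊ − λ₋)/ω₀) − √(1 + r²) = 0` (`ω₀ > 0`) — the probe's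
parameter-free «layer_residual» is identically zero on a Burgers layer, for every stretching `γ`. -/
theorem layer_residual_eq_zero {ω₀ γ : ℝ} (hω : 0 < ω₀) :
    ((-γ + sqrt (γ ^ 2 + ω₀ ^ 2)) / 2 - (-γ - sqrt (γ ^ 2 + ω₀ ^ 2)) / 2) / ω₀ - sqrt (1 + (γ / ω₀) ^ 2) = 0 := by
  rw [lam_plus_sub_lam_minus_eq_ratio hω]
  field_simp
  ring

/-- The plain sheet `γ = 0`: spread exactly `ω₀` (`= λ₊ − λ₋ = ω₀/2 − (−ω₀/2)`). -/
theorem sheet_spread {ω₀ : ℝ} (hω : 0 ≤ ω₀) :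
    (-(0:ℝ) + sqrt ((0:ℝ) ^ 2 + ω₀ ^ 2)) / 2 - (-(0:ℝ) - sqrt ((0:ℝ) ^ 2 + ω₀ ^ 2)) / 2 = ω₀ := by
  rw [lam_plus_sub_lam_minus]
  simp [sqrt_sq hω]

/-- STRETCHING ONLY WIDENS THE SPREAD: `λ₊ − λ₋ = √(γ² + ω₀²) ≥ |ω₀|` — a measured in-plane spread BELOW the local
vorticity magnitude cannot come from a single strained layer (residual `< 0` flags «not a layer» as surely as `≫ 0`). -/
theorem spread_ge_omega (ω₀ γ : ℝ) :
    |ω₀| ≤ (-γ + sqrt (γ ^ 2 + ω₀ ^ 2)) / 2 - (-γ - sqrt (γ ^ 2 + ω₀ ^ 2)) / 2 := by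
  rw [lam_plus_sub_lam_minus, ← sqrt_sq_eq_abs]
  exact sqrt_le_sqrt (by nlinarith [sq_nonneg γ])

/-- At the record point `r = 0.058` (run 1a-R300-N128-A, 5.80 T_h): `√(1 + r²) ∈ (1.00168, 1.00169)`
(`BurgersLayerStrain.record_sqrt_bounds`) — the measured spread `(0.476 + 0.534)|ω_loc| = 1.010|ω_loc|` sits `+0.008`
above it, the number the v1.2 probe prints as layer_residual there. -/
theorem record_spread_bounds :
    (1.00168:ℝ) < sqrt (1 + (0.058:ℝ) ^ 2) ∧ sqrt (1 + (0.058:ℝ) ^ 2) < (1.00169:ℝ) := by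
  have e : (1:ℝ) + (0.058:ℝ) ^ 2 = 1.003364 := by norm_num
  rw [e]
  exact BurgersLayerStrain.record_sqrt_bounds

end Summit.NavierStokesRegularity.FluidComputer.BurgersLayerResidual
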